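import Summits.Ventures.HodgeRepro.Night3LemmaPCore

/-!
# The WEIL MODEL: Lemma P's product closure and cancellation as theorems

Blind re-derivation cell `pub-hodge-repro`, seat `night-3` (gen 2).  Imports `Night3LemmaPCore` (Mathlib only).
Namespace `HodgeRepro.Night3`.

`Night3FaceClosure.alg_of_faces` («S4-faces ⟹ S4») takes Lemma P as two HYPOTHESES on the predicate
`Alg M = «W_F(B_M)` is algebraic»: product closure `hadd` (LEMMA-L-P-v2.md, Lemma P step (1)) and cancellation `hcancel`
(steps (2)–(3)).  This file states an abstract model of the route's objects — a `WeilModel` — in which both are THEOREMS.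
Over a field extension `K ⊆ L` (`ℚ ⊆ ℂ`), a finite index set `ι` (the embeddings `σ : F → ℂ`) and a commutative monoid `A`
of indices (multisets `M` of CM types; `M + N ↦ B_M × B_N`), a model assigns to every `a : A`

* a `K`-space `H a` (`H^•(B_a, ℚ)`), the Künneth map `κ a b : H (a + b) → H a ⊗ H b`, lines `ℓ a σ ∈ L ⊗ H a`
  (the generators `w_σ(B_a) = ⊗_i w_σ^{(i)}` of the `σ`-lines), the Weil space `W a` with
  `(W a) ⊗ L = span {ℓ a σ}` (`hW`) and the eigenline identification `κ_L (ℓ (a+b) σ) = ℓ a σ ⊗ ℓ b σ` (`hℓ`);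
* the algebraic classes `Alg a` with `κ⁻¹ (Alg a ⊗ Alg b) ≤ Alg (a + b)` (`hmul`: products of pull-backs of algebraic
  classes are algebraic) and, for `y ∈ Alg b`, the correspondence `(id ⊗ Q_b(·, y)) ∘ κ : H (a+b) → H a` mapping
  `Alg (a + b)` into `Alg a` (`hproj`: the projection formula for `pr_{B_a *}((·) ∪ pr_{B_b}^*(y ∪ Λ))`);
* a rational form `Q a` on `H a` (`Q′(x, y) = ∫ x ∪ y ∪ Λ`) such that for `b ≠ 0` every line `ℓ b σ` pairs non-trivially
  with SOME line `ℓ b τ` (`hQ`: the anti-diagonal Gram matrix of step (2), non-zero at `τ = σ̄`, weakened to what the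
  proof uses; for `b = 0`, `B_∅` = point, all lines are `1` and the condition fails — hence `b ≠ 0`).

Theorems: `WeilModel.alg_add` (= `hadd`, step (1): Künneth descent), `WeilModel.alg_cancel` (= `hcancel`, steps (2)–(3):
the rational witness `y ∈ W b` of `exists_mem_forall_ne_zero`, the contraction `Φ = contract (Q b (·, y)) ∘ κ`,
`Φ (W (a+b)) = W a`).  Both hold for ALL `a b : A`, zero-sum or not.  `Night3WeilModelFaces` composes them with
`alg_of_faces`.  Nothing here closes S4; no sealed file is touched; no Tier-2 item depends on this file.
-/

set_option autoImplicit false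

open TensorProduct

namespace HodgeRepro.Night3

universe u

/-- A **Weil model** over the field extension `K ⊆ L`, the index set `ι` of embeddings and the index monoid `A` of
corner products: the objects Lemma P (LEMMA-L-P-v2.md) speaks about, with the five Hodge-theoretic identifications of its
proof as fields (`hW`, `hℓ`, `hmul`, `hproj`, `hQ`).  See the module docstring for the reading of each field. -/
structure WeilModel (K L : Type*) [Field K] [Field L] [Algebra K L] (ι : Type*) (A : Type*) [AddCommMonoid A] where
  /-- the rational cohomology `H^•(B_a, ℚ)` -/
  H : A → Type u
  [acg : ∀ a, AddCommGroup (H a)]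
  [mod : ∀ a, Module K (H a)]
  /-- the Künneth map `H^•(B_a × B_b) → H^•(B_a) ⊗ H^•(B_b)` (used only as a linear map) -/
  κ : ∀ a b, H (a + b) →ₗ[K] H a ⊗[K] H b
  /-- the generator `w_σ(B_a)` of the `σ`-line, in `H^•(B_a) ⊗ ℂ` -/
  ℓ : ∀ a, ι → L ⊗[K] H a
  /-- the Weil space `W_F(B_a)` (a `K`-form) -/
  W : ∀ a, Submodule K (H a)
  /-- the algebraic classes of `B_a` -/
  Alg : ∀ a, Submodule K (H a)
  /-- the rational form `Q′(x, y) = ∫_{B_a} x ∪ y ∪ Λ` -/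
  Q : ∀ a, LinearMap.BilinForm K (H a)
  /-- `W_F(B_a) ⊗ ℂ = ⊕_σ ℓ_σ(B_a)` -/
  hW : ∀ a, (W a).baseChange L = Submodule.span L (Set.range (ℓ a))
  /-- the eigenline identification `ℓ_σ(B_a × B_b) = ℓ_σ(B_a) ⊗ ℓ_σ(B_b)` under Künneth -/
  hℓ : ∀ a b σ, (κ a b).baseChange L (ℓ (a + b) σ) =
    (AlgebraTensorModule.distribBaseChange K L (H a) (H b)).symm (ℓ a σ ⊗ₜ[L] ℓ b σ)
  /-- products of pull-backs of algebraic classes are algebraic -/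
  hmul : ∀ a b, (Submodule.map₂ (TensorProduct.mk K (H a) (H b)) (Alg a) (Alg b)).comap (κ a b) ≤ Alg (a + b)
  /-- the correspondence `pr_{B_a *}((·) ∪ pr_{B_b}^*(y ∪ Λ))`, `y` algebraic, maps algebraic classes to algebraic
  classes (in the Künneth model: the contraction against `Q_b(·, y)`) -/
  hproj : ∀ a b (y : H b), y ∈ Alg b →
    ((Alg (a + b)).map (κ a b)).map (LemmaP.contract ((Q b).flip y)) ≤ Alg a
  /-- the anti-diagonal Gram matrix of `Q′` on the lines, weakened: for `b ≠ 0` every line pairs non-trivially with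
  some line -/
  hQ : ∀ b, b ≠ 0 → ∀ σ, ∃ τ, (Q b).baseChange L (ℓ b σ) (ℓ b τ) ≠ 0

attribute [instance] WeilModel.acg WeilModel.mod

namespace WeilModel

variable {K L : Type*} [Field K] [Field L] [Algebra K L] {ι : Type*} {A : Type*} [AddCommMonoid A]

/-- The field `hQ` from the paper's statement: an ANTI-DIAGONAL Gram matrix of `Q_b ⊗ L` on the lines, along a fixed
`conj : ι → ι` (`σ ↦ σ̄`) — `Q′(w′_σ, w′_τ) ≠ 0 ↔ τ = σ̄` (LEMMA-L-P-v2.md, step (2)) — gives `hQ` with `τ := conj σ`. -/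
theorem hQ_of_antidiagonal {H : A → Type u} [∀ a, AddCommGroup (H a)] [∀ a, Module K (H a)]
    (ℓ : ∀ a, ι → L ⊗[K] H a) (Q : ∀ a, LinearMap.BilinForm K (H a)) (conj : ι → ι)
    (h : ∀ b, b ≠ 0 → ∀ σ τ, (Q b).baseChange L (ℓ b σ) (ℓ b τ) ≠ 0 ↔ τ = conj σ) :
    ∀ b, b ≠ 0 → ∀ σ, ∃ τ, (Q b).baseChange L (ℓ b σ) (ℓ b τ) ≠ 0 :=
  fun b hb σ => ⟨conj σ, (h b hb σ (conj σ)).mpr rfl⟩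

variable (X : WeilModel.{u} K L ι A)

/-- Every line lies in the base change of the Weil space. -/
theorem line_mem_baseChange (a : A) (σ : ι) : X.ℓ a σ ∈ (X.W a).baseChange L := by
  rw [X.hW]; exact Submodule.subset_span ⟨σ, rfl⟩

/-- **Lemma P, step (1) — product closure, as a theorem**: if `W_F(B_a)` and `W_F(B_b)` are algebraic, so is
`W_F(B_a × B_b)`.  Proof: `κ (W (a+b))` has base change spanned by the `ℓ a σ ⊗ ℓ b σ` (`hℓ`), hence lies in
`W a ⊗ W b ≤ Alg a ⊗ Alg b` by Künneth descent (`le_map₂_of_baseChange_eq_span`), and `hmul` finishes. -/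
theorem alg_add (a b : A) (ha : X.W a ≤ X.Alg a) (hb : X.W b ≤ X.Alg b) :
    X.W (a + b) ≤ X.Alg (a + b) := by
  have hV : ((X.W (a + b)).map (X.κ a b)).baseChange L = Submodule.span L (Set.range fun σ =>
      (AlgebraTensorModule.distribBaseChange K L (X.H a) (X.H b)).symm (X.ℓ a σ ⊗ₜ[L] X.ℓ b σ)) := by
    rw [LemmaP.baseChange_map, X.hW, Submodule.map_span, ← Set.range_comp]
    exact congrArg (Submodule.span L) (congrArg Set.range (funext fun σ => X.hℓ a b σ))
  have h1 : (X.W (a + b)).map (X.κ a b) ≤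
      Submodule.map₂ (TensorProduct.mk K (X.H a) (X.H b)) (X.W a) (X.W b) :=
    LemmaP.le_map₂_of_baseChange_eq_span hV (X.line_mem_baseChange a) (X.line_mem_baseChange b)
  calc X.W (a + b) ≤ ((X.W (a + b)).map (X.κ a b)).comap (X.κ a b) := Submodule.le_comap_map _ _
    _ ≤ (Submodule.map₂ (TensorProduct.mk K (X.H a) (X.H b)) (X.Alg a) (X.Alg b)).comap (X.κ a b) :=
        Submodule.comap_mono (h1.trans (Submodule.map₂_le_map₂ ha hb))
    _ ≤ X.Alg (a + b) := X.hmul a b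

/-- **Lemma P, steps (2)–(3) — cancellation, as a theorem**: if `W_F(B_a × B_b)` and `W_F(B_b)` are algebraic, so is
`W_F(B_a)`.  Proof: for `b = 0` the hypothesis is the conclusion.  For `b ≠ 0`, `exists_mem_forall_ne_zero` gives a
rational `y ∈ W b` with `c_σ := Q_b ⊗ L (ℓ b σ, 1 ⊗ y) ≠ 0` for every `σ` (`hQ`); the contraction
`Φ := contract (Q_b(·, y)) ∘ κ : H (a+b) → H a` sends `ℓ (a+b) σ ↦ c_σ • ℓ a σ` (`hℓ`, the projection formula), so
`Φ (W (a+b)) = W a` (`map_eq_of_baseChange_span`); and `Φ (W (a+b)) ≤ Φ (Alg (a+b)) ≤ Alg a` (`hproj`, `y ∈ Alg b`). -/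
theorem alg_cancel [Infinite K] [Fintype ι] (a b : A) (hab : X.W (a + b) ≤ X.Alg (a + b))
    (hb : X.W b ≤ X.Alg b) : X.W a ≤ X.Alg a := by
  by_cases h0 : b = 0
  · subst h0; rwa [add_zero] at hab
  obtain ⟨y, hyW, hy⟩ := LemmaP.exists_mem_forall_ne_zero (L := L) (X.W b)
    (fun σ => (X.Q b).baseChange L (X.ℓ b σ)) (fun σ => by
      obtain ⟨τ, hτ⟩ := X.hQ b h0 σ
      exact ⟨X.ℓ b τ, X.line_mem_baseChange b τ, hτ⟩)
  let φ : Module.Dual K (X.H b) := (X.Q b).flip y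
  let Φ : X.H (a + b) →ₗ[K] X.H a := LemmaP.contract φ ∘ₗ X.κ a b
  have hc : ∀ σ, LemmaP.extendDual (L := L) φ (X.ℓ b σ) ≠ 0 := fun σ => by
    rw [LemmaP.extendDual_flip_eq_baseChange]; exact hy σ
  have hΦ : ∀ σ, Φ.baseChange L (X.ℓ (a + b) σ) = LemmaP.extendDual (L := L) φ (X.ℓ b σ) • X.ℓ a σ := by
    intro σ
    show (LemmaP.contract φ ∘ₗ X.κ a b).baseChange L (X.ℓ (a + b) σ) = _
    rw [LinearMap.baseChange_comp, LinearMap.comp_apply, X.hℓ,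
      LemmaP.baseChange_contract_distribBaseChange_symm_tmul]
  have hmap : (X.W (a + b)).map Φ = X.W a :=
    LemmaP.map_eq_of_baseChange_span Φ (X.ℓ (a + b)) (X.ℓ a) _ hc hΦ (X.hW _) (X.hW _)
  rw [← hmap]
  calc (X.W (a + b)).map Φ ≤ (X.Alg (a + b)).map Φ := Submodule.map_mono hab
    _ = ((X.Alg (a + b)).map (X.κ a b)).map (LemmaP.contract φ) := Submodule.map_comp _ _ _
    _ ≤ X.Alg a := X.hproj a b y (hb hyW)

end WeilModel

end HodgeRepro.Night3
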